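import Mathlib.RingTheory.MvPolynomial.EulerIdentity
import Mathlib.RingTheory.MvPolynomial.Homogeneous
import Mathlib.Algebra.MvPolynomial.PDeriv
import Mathlib.Algebra.MvPolynomial.NoZeroDivisors
import Mathlib.Algebra.CharP.Algebra
import Mathlib.Algebra.CharP.Two
import Mathlib.Algebra.CharP.Lemmas
import Mathlib.Data.Fin.VecNotation

/-!
# Odd anisotropic binary forms are never almost-`(d-1)`-st powers (K-β7 block (f); W4.1, OURS)

Kernel block (f) of the K-β7 plan (`FormalCentreDescent`, β-slot hβ6′ of the W4.1 leaf; memo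
`CANONICAL-CLEANING-g10.md` §12.4–§12.5 of res-L0-w41-idea-1): over a field `κ` of characteristic `2`,
a binary form `Ψ(Z, W)` of ODD degree `d` which is ANISOTROPIC over `κ` (no zero in `κ² ∖ 0`) is divisible
by the `(d-1)`-st power of a non-zero linear form `ℓ = t₂ Z + t₁ W` over NO extension field `L ⊇ κ` —
no perfectness, no algebraicity of `L / κ`, no `3 ≤ d` needed (for `d = 1` the hypotheses are void).

Proof (a derivative shortcut replacing the memo's minimal-polynomial casework, valid exactly in the case the
leaf consumes: characteristic `2`, `d` odd). If `Ψ_L = ℓ^{d-1}·m`, then `d - 1` is even, so both partial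
derivatives kill `ℓ^{d-1}`: `∂_i Ψ_L = ℓ^{d-1}·∂_i m`; a degree count makes `∂_i m` constants `c_i`;
Euler (`d` odd: `Z ∂_Z Ψ + W ∂_W Ψ = Ψ`) gives `Ψ_L = ℓ^{d-1}(c₀ Z + c₁ W)`. If `c₁ = 0` then `∂_W Ψ = 0`
and `Ψ = Z·∂_Z Ψ` vanishes at `(0, 1)`; if `c₁ ≠ 0` then `∂_Z Ψ = γ·∂_W Ψ` with `γ = c₀ / c₁`, and comparing
one non-zero coefficient shows `γ ∈ κ`, whence `Ψ = (γ Z + W)·∂_W Ψ` vanishes at the `κ`-point `(1, γ)`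
(characteristic `2`). Either way anisotropy over `κ` is contradicted.

This is the any-field input of memo §12.3 step (4) (the coefficient field `κ′` of a second formal branch may be
an inseparable extension of `κ`, so the perfect-field word `AnisotropicNoAlmostPower` of
`…SteerVertexDescentWords` does not apply there). Everything here is OURS (the run's own bookkeeping),
AI-written and AI-checked only — weaker than expert review; nothing is a statement of [Hironaka2017]. -/

set_option linter.dupNamespace false
set_option autoImplicit false

namespace Summit.ResolutionOfSingularities.ResolutionOfSingularities.Theorems.SwitchingDichotomy.OddAnisotropic

open MvPolynomial

variable {κ L : Type*} [Field κ] [Field L] [Algebra κ L]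

/-- In characteristic `2`, an odd natural number is `1` in any `MvPolynomial` ring over `L`. -/
theorem natCast_eq_one_of_odd [CharP L 2] {σ : Type*} {d : ℕ} (hd : Odd d) :
    ((d : ℕ) : MvPolynomial σ L) = 1 := by
  obtain ⟨k, rfl⟩ := hd
  have h2 : ((2 : ℕ) : MvPolynomial σ L) = 0 := CharP.cast_eq_zero _ 2
  push_cast at h2 ⊢
  rw [h2, zero_mul, zero_add]

/-- In characteristic `2`, `d - 1` vanishes in any `MvPolynomial` ring over `L` when `d` is odd. -/
theorem natCast_pred_eq_zero_of_odd [CharP L 2] {σ : Type*} {d : ℕ} (hd : Odd d) :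
    ((d - 1 : ℕ) : MvPolynomial σ L) = 0 := by
  obtain ⟨k, rfl⟩ := hd
  have h2 : ((2 : ℕ) : MvPolynomial σ L) = 0 := CharP.cast_eq_zero _ 2
  rw [Nat.add_sub_cancel]
  push_cast at h2 ⊢
  rw [h2, zero_mul]

/-- Euler's identity for a binary form of odd degree in characteristic `2`:
`Z·∂_Z Ψ + W·∂_W Ψ = Ψ`. -/
theorem euler_two_odd [CharP L 2] {d : ℕ} (hd : Odd d) {Ψ : MvPolynomial (Fin 2) L}
    (hΨ : Ψ.IsHomogeneous d) : X 0 * pderiv 0 Ψ + X 1 * pderiv 1 Ψ = Ψ := by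
  have h := hΨ.sum_X_mul_pderiv
  rw [Fin.sum_univ_two, nsmul_eq_mul, natCast_eq_one_of_odd hd, one_mul] at h
  exact h

/-- The linear form `ℓ = t₂ Z + t₁ W` is homogeneous of degree `1`. -/
theorem isHomogeneous_linearForm (t₁ t₂ : L) :
    (C t₂ * X 0 + C t₁ * X 1 : MvPolynomial (Fin 2) L).IsHomogeneous 1 := by
  have h0 : (C t₂ * X 0 : MvPolynomial (Fin 2) L).IsHomogeneous (0 + 1) :=
    (isHomogeneous_C _ _).mul (isHomogeneous_X _ _)
  have h1 : (C t₁ * X 1 : MvPolynomial (Fin 2) L).IsHomogeneous (0 + 1) :=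
    (isHomogeneous_C _ _).mul (isHomogeneous_X _ _)
  simpa using h0.add h1

/-- In characteristic `2`, for odd `d`, the partial derivatives of `ℓ^{d-1}·m` are `ℓ^{d-1}·∂_i m`
(`d - 1` is even, so `∂_i ℓ^{d-1} = (d-1) ℓ^{d-2} ∂_i ℓ = 0`). -/
theorem pderiv_linearPow_mul [CharP L 2] {d : ℕ} (hd : Odd d) (t₁ t₂ : L)
    (m : MvPolynomial (Fin 2) L) (i : Fin 2) :
    pderiv i ((C t₂ * X 0 + C t₁ * X 1) ^ (d - 1) * m) =
      (C t₂ * X 0 + C t₁ * X 1) ^ (d - 1) * pderiv i m := by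
  rw [pderiv_mul, pderiv_pow, natCast_pred_eq_zero_of_odd hd, zero_mul, zero_mul, zero_mul, zero_add]

/-- Degree count: if `ℓ^{d-1}·n` (with `ℓ ≠ 0` linear) has total degree `≤ d - 1`, then `n` is a constant. -/
theorem eq_C_of_linearPow_mul {d : ℕ} {t₁ t₂ : L} (hℓ : (C t₂ * X 0 + C t₁ * X 1 : MvPolynomial (Fin 2) L) ≠ 0)
    {n : MvPolynomial (Fin 2) L}
    (hdeg : ((C t₂ * X 0 + C t₁ * X 1) ^ (d - 1) * n).totalDegree ≤ d - 1) :
    n = C (coeff 0 n) := by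
  by_cases hn : n = 0
  · simp [hn]
  have hpow : ((C t₂ * X 0 + C t₁ * X 1 : MvPolynomial (Fin 2) L) ^ (d - 1)) ≠ 0 := pow_ne_zero _ hℓ
  have hdegpow : ((C t₂ * X 0 + C t₁ * X 1 : MvPolynomial (Fin 2) L) ^ (d - 1)).totalDegree = d - 1 := by
    have h := ((isHomogeneous_linearForm t₁ t₂).pow (d - 1)).totalDegree hpow
    simpa using h
  rw [totalDegree_mul_of_isDomain hpow hn, hdegpow] at hdeg
  have h0 : n.totalDegree = 0 := by omega
  exact (totalDegree_eq_zero_iff_eq_C).mp h0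

/-- **Odd anisotropic binary forms are never almost-powers, over any extension field** (memo §12.4, the
characteristic-`2` case the leaf consumes). `κ ⊆ L` fields, `char κ = 2`, `Ψ ∈ κ[Z, W]` homogeneous of odd
degree `d` with `Ψ(a, b) ≠ 0` for all `(a, b) ∈ κ² ∖ 0`; then for every non-zero `(t₁, t₂) ∈ L²` and every
`m ∈ L[Z, W]`, `Ψ ⊗ L ≠ (t₂ Z + t₁ W)^{d-1} · m`. OURS. -/
theorem map_ne_linearPow_mul_of_anisotropic [CharP κ 2] {d : ℕ} (hd : Odd d)
    {Ψ : MvPolynomial (Fin 2) κ} (hΨ : Ψ.IsHomogeneous d)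
    (han : ∀ a b : κ, (a ≠ 0 ∨ b ≠ 0) → eval ![a, b] Ψ ≠ 0)
    (t₁ t₂ : L) (ht : t₁ ≠ 0 ∨ t₂ ≠ 0) (m : MvPolynomial (Fin 2) L) :
    map (algebraMap κ L) Ψ ≠ (C t₂ * X 0 + C t₁ * X 1) ^ (d - 1) * m := by
  intro hm
  have hφ : Function.Injective (algebraMap κ L) := (algebraMap κ L).injective
  haveI : CharP L 2 := charP_of_injective_algebraMap hφ 2
  set φ := algebraMap κ L with hφdef
  set ℓ : MvPolynomial (Fin 2) L := C t₂ * X 0 + C t₁ * X 1 with hℓdef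
  -- `ℓ ≠ 0`
  have hℓ : ℓ ≠ 0 := by
    intro h0
    rcases ht with h | h
    · have hc : coeff (Finsupp.single 1 1) ℓ = t₁ := by
        rw [hℓdef, coeff_add, coeff_C_mul, coeff_C_mul, coeff_single_X, coeff_single_X]
        simp
      rw [h0, coeff_zero] at hc
      exact h hc.symm
    · have hc : coeff (Finsupp.single 0 1) ℓ = t₂ := by
        rw [hℓdef, coeff_add, coeff_C_mul, coeff_C_mul, coeff_single_X, coeff_single_X]
        simp
      rw [h0, coeff_zero] at hc
      exact h hc.symm
  -- the partial derivatives of `Ψ_L` are `ℓ^{d-1}` times constants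
  have hhomL : (map φ Ψ).IsHomogeneous d := hΨ.map φ
  have hconst : ∀ i : Fin 2, pderiv i m = C (coeff 0 (pderiv i m)) := by
    intro i
    apply eq_C_of_linearPow_mul hℓ
    have h1 : ℓ ^ (d - 1) * pderiv i m = pderiv i (map φ Ψ) := by
      rw [hm, hℓdef, pderiv_linearPow_mul hd]
    rw [h1]
    exact (hhomL.pderiv (i := i)).totalDegree_le
  have hpdL : ∀ i : Fin 2, map φ (pderiv i Ψ) = ℓ ^ (d - 1) * C (coeff 0 (pderiv i m)) := by
    intro i
    rw [← pderiv_map, hm, hℓdef, pderiv_linearPow_mul hd, ← hconst i]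
  set c₀ : L := coeff 0 (pderiv 0 m) with hc₀
  set c₁ : L := coeff 0 (pderiv 1 m) with hc₁
  -- Euler over `κ`
  have hEκ : X 0 * pderiv 0 Ψ + X 1 * pderiv 1 Ψ = Ψ := euler_two_odd hd hΨ
  by_cases h1 : c₁ = 0
  · -- `∂_W Ψ = 0`, so `Ψ = Z ∂_Z Ψ` vanishes at `(0, 1)`
    have hG1 : pderiv 1 Ψ = 0 := by
      apply map_injective φ hφ
      rw [hpdL 1, ← hc₁, h1, C_0, mul_zero, map_zero]
    have hzero : eval ![(0 : κ), 1] Ψ = 0 := by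
      rw [← hEκ, hG1, mul_zero, add_zero, eval_mul, eval_X]
      simp
    exact han 0 1 (Or.inr one_ne_zero) hzero
  · -- `∂_Z Ψ = γ ∂_W Ψ` with `γ ∈ κ`; then `Ψ = (γ Z + W) ∂_W Ψ` vanishes at `(1, γ)`
    have hG1ne : pderiv 1 Ψ ≠ 0 := by
      intro h0
      have := hpdL 1
      rw [h0, map_zero] at this
      exact (mul_ne_zero (pow_ne_zero _ hℓ) (by rwa [Ne, C_eq_zero])) this.symm
    obtain ⟨s, hs⟩ := exists_coeff_ne_zero hG1ne
    have hrel : map φ (pderiv 0 Ψ) = C (c₀ / c₁) * map φ (pderiv 1 Ψ) := by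
      rw [hpdL 0, hpdL 1, ← hc₀, ← hc₁]
      rw [show C (c₀ / c₁) * (ℓ ^ (d - 1) * C c₁) = ℓ ^ (d - 1) * C c₀ by
        rw [mul_left_comm, ← C_mul, div_mul_cancel₀ _ h1]]
    set γ₀ : κ := coeff s (pderiv 0 Ψ) / coeff s (pderiv 1 Ψ) with hγ₀
    have hγ : c₀ / c₁ = φ γ₀ := by
      have h := congrArg (coeff s) hrel
      rw [coeff_map, coeff_C_mul, coeff_map] at h
      rw [hγ₀, map_div₀, h, mul_div_assoc, div_self ((map_ne_zero φ).mpr hs), mul_one]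
    have hG0 : pderiv 0 Ψ = C γ₀ * pderiv 1 Ψ := by
      apply map_injective φ hφ
      rw [hrel, hγ, map_mul, map_C]
    have hzero : eval ![(1 : κ), γ₀] Ψ = 0 := by
      rw [← hEκ, hG0, eval_add, eval_mul, eval_mul, eval_mul, eval_X, eval_X, eval_C]
      simp only [Matrix.cons_val_zero, Matrix.cons_val_one]
      rw [one_mul, ← add_mul, CharTwo.add_self_eq_zero, zero_mul]
    exact han 1 γ₀ (Or.inl one_ne_zero) hzero

/-- Partial-derivative form of the same obstruction (the shape memo §12.3 step (4) produces along a second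
formal branch): if over some extension `L` both partials of `Ψ ⊗ L` are constant multiples of `ℓ^{d-1}` for a
non-zero linear form `ℓ = t₂ Z + t₁ W`, with `Ψ` anisotropic of odd degree over `κ` of characteristic `2`,
then `False` (Euler: `Ψ ⊗ L = ℓ^{d-1}(α Z + β W)`). OURS. -/
theorem false_of_pderiv_eq_linearPow [CharP κ 2] {d : ℕ} (hd : Odd d)
    {Ψ : MvPolynomial (Fin 2) κ} (hΨ : Ψ.IsHomogeneous d)
    (han : ∀ a b : κ, (a ≠ 0 ∨ b ≠ 0) → eval ![a, b] Ψ ≠ 0)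
    (t₁ t₂ : L) (ht : t₁ ≠ 0 ∨ t₂ ≠ 0) (α β : L)
    (h0 : pderiv 0 (map (algebraMap κ L) Ψ) = C α * (C t₂ * X 0 + C t₁ * X 1) ^ (d - 1))
    (h1 : pderiv 1 (map (algebraMap κ L) Ψ) = C β * (C t₂ * X 0 + C t₁ * X 1) ^ (d - 1)) : False := by
  have hφ : Function.Injective (algebraMap κ L) := (algebraMap κ L).injective
  haveI : CharP L 2 := charP_of_injective_algebraMap hφ 2
  have hE := euler_two_odd hd (hΨ.map (algebraMap κ L))
  rw [h0, h1] at hE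
  apply map_ne_linearPow_mul_of_anisotropic hd hΨ han t₁ t₂ ht (C α * X 0 + C β * X 1)
  rw [← hE]
  ring

/-! ## PART 2 — the typed word, by name (idea-1 `K7Words-idea-1-g10.lean` 9000aedaa13a2063 l.47, VERBATIM,
namespace re-based as for FILE 0 `…SteerVertexDescentWords`), discharged by PART 1. -/

/-- ODD ANISOTROPIC FORMS ARE NEVER ALMOST-`(d−1)`-POWERS (memo §12.4; res-L0-w41-idea-1's typed word, VERBATIM).
`κ` a field of characteristic `2`, `L ⊇ κ` ANY field extension, `Ψ ∈ κ[Z, W]` homogeneous of ODD degree `d ≥ 3`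
and anisotropic over `κ` (no non-trivial zero in `κ²`): no non-zero linear form `t₂ Z + t₁ W` over `L` divides
`Ψ` to the power `d − 1`. OURS. -/
def OddAnisotropicNoAlmostPower : Prop :=
  ∀ (κ L : Type) [Field κ] [Field L] [CharP κ 2] [Algebra κ L] (d : ℕ) (Ψ : MvPolynomial (Fin 2) κ),
    3 ≤ d → Odd d → Ψ.IsHomogeneous d →
    (∀ a b : κ, (a ≠ 0 ∨ b ≠ 0) → MvPolynomial.eval ![a, b] Ψ ≠ 0) →
    ¬ ∃ (t₁ t₂ : L) (m : MvPolynomial (Fin 2) L), (t₁ ≠ 0 ∨ t₂ ≠ 0) ∧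
        MvPolynomial.map (algebraMap κ L) Ψ = (C t₂ * X 0 + C t₁ * X 1) ^ (d - 1) * m

/-- The word `OddAnisotropicNoAlmostPower` HOLDS (by `map_ne_linearPow_mul_of_anisotropic`; the binder `3 ≤ d`
is not used). OURS. -/
theorem oddAnisotropicNoAlmostPower_holds : OddAnisotropicNoAlmostPower :=
  fun _κ _L _ _ _ _ _d _Ψ _ hd hΨ han ⟨t₁, t₂, m, ht, h⟩ =>
    map_ne_linearPow_mul_of_anisotropic hd hΨ han t₁ t₂ ht m h

end Summit.ResolutionOfSingularities.ResolutionOfSingularities.Theorems.SwitchingDichotomy.OddAnisotropic
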